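import Summits.QuantumFields.BalabanUV.Beta.RemainderExplicitUnits
import Summits.QuantumFields.BalabanUV.Beta.RemainderExplicitLaplacian
import Summits.QuantumFields.BalabanUV.Beta.RemainderExplicitDivGrad

/-!
# Beta / RemainderExplicitSecondOrder — BINDER-OWNERS row D4, ROAD P3 (co-owner #3, unit `b2b-balaban-beta-d4-p3`), skeleton leaves
# E3.3 (assembly) + E4 (second instalment): THE TWO SECOND-ORDER COMPONENTS OF THE (3.14)/(4.4) NORM OF THE BAŁABAN-NORMALISED
# TEST CONFIGURATION `h = N^5·wH^{(N)}` ARE LEVEL-FREE — `N²·|Δh|` and `N²·|d d* h|` — AND ALL FOUR COMPONENTS WITH ONE `(κ₀, C)`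

HONEST FRAMING (page 1 of everything the β sub-cell writes): discharging `BetaPertH` makes Bałaban's UV stability
UNCONDITIONAL — a real constructive-QFT result; it is NOT the continuum limit and NOT the Clay problem.  HONEST DEPENDENCY
(verbatim): «continuum YM on T⁴ ⇐ BetaPertH ∧ nine spine estimates (0/9 proved); BetaPertH ⇐ (D1) ∧ (D4) ∧ CAP+tail;
G-an2-4 gates asym, D1 and NE2/3/4.»  NOT IN PRINT; OUR BOOKKEEPING.  `[folklore]`: (i) the finite-difference identity
`curvAdj (curv A) = 2·Δ_vec A − 2·dz (codiff₁ A)` for the tree's lattice operators (`AffineAveraging`: `curv` on ALL ordered pairs,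
so `curvAdj ∘ curv` is twice the standard `d*d`; `Δ_vec` = the componentwise positive lattice Laplacian `Σ_μ (2A_ν(x) − A_ν(x+e_μ) −
A_ν(x−e_μ))`); (ii) the level-uniform bounds of road P3's `RemainderExplicitLaplacian.exists_curvAdj_curv_wH_decay` (`|d*d wH| ≲ N^{−7}`,
via an5's gauge-free Euler–Lagrange identity) and `RemainderExplicitDivGrad.exists_ddwH_decay` (`|d d* wH| ≲ N^{−7}`, via the pure-gauge
longitudinal content of the alias amplitudes) moved across the units dictionary of `RemainderExplicitUnits` (`h = N^5·wH`, `Δ^η = N²·Δ`,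
UNITS-E4 §5).  No cited fact, no wall binder, no `def … : Prop`; nothing about Bałaban's densities is asserted.  NOT summit progress.

ABSOLUTE RULE (cell charter, verbatim): "No internally-minted statement may enter as a cited fact. Every hypothesis is
either kernel-proved in this package or a verbatim quotation of a PUBLISHED theorem with page reference. The manuscript(s)
under audit are NOT citable for their own disputed steps — they are the thing under adjudication; programme-internal
(2001/route/tribunal) claims are never citable."

## Why road P3 wants this (skeleton `HOME/beta/skeletons/D4-b2b-balaban-beta-d4-p3.md` §3 leaves E3/E4, §5 risk ρ2)

[Balaban1987RG1] (4.4) p. 281: `𝐄^{(j)}(X, exp iξ𝐀)` is analytic for `max{|𝐀|_X, |P₁(□₀)𝐀|_X, |∇^ξ𝐀|_X, |Δ^ξ𝐀|_X} < α₂`; p. 282: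
«The norm in (4.4) of the expression ⟨δ^{n(p)}𝐇_j(□₀,0)/δB^{n(p)}, ⊗B_i⟩ can be estimated by B₃∏|B_i|, and if one of the functions
B_i is localized outside the domain X, then we have the additional exponential factor exp(−δ₀dist^{(ξ)}(X, supp B_i))» — a `j`-UNIFORM
`B₃`.  On road P3 the test configuration is READ (rows D1/D4, (R13-2)/(R14-1); NOT asserted here) as `h = N^{d+2}·wH^{(N)}`, `N = ξ⁻¹ =
L^j`, and p. 272 («RD*𝐇_j = 0 … D*D + DRD* = D*D + DD* − DPD* = Δ − P₁») with [Balaban1984PropagatorsI] (1.44)/(1.49) p. 26 (`R` =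
the orthogonal projector onto `ΔN(Q′)`, so `R∂*A = 0 ⟺ Δ∂*A` block-constant = the typed weak gauge (G) of `Beta/BlochFibreMatrix`,
`KernelSpecInstance.wH_G`) reads `P₁h = d(1 − R)d*h = d d* h`.  THIS FILE's kernel content: with ONE `(κ₀, C)` for EVERY level,
`|h| , N·|∇h| , N²·|Δ_vec h| , N²·|d d* h| ≤ C·e^{−κ₀·(block distance)}` — all four (3.14)-type components of the typed test
configuration are LEVEL-FREE, i.e. the tree's explicit operator is CONSISTENT with print's `j`-uniform `B₃` (skeleton §5 risk ρ2
discharged for all four components; had any exponent disagreed, either p. 282's uniformity or the reading (R13-2) would fail for the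
same explicit operator — reportable to row D1 either way).  The identification `P₁(□₀)h = d d* h` itself (the `□₀`-adapted gauge of
[I] (3.20)–(3.37) vs the tree's weak Landau gauge; `RemainderExplicitGaugeNull`: linearised-gauge directions are Hessian-null) stays
part of the residual reading (R.e) of `RemainderExplicitRoad`, not of this file.
-/

noncomputable section

open Finset
open scoped BigOperators
open Literature.MathematicalPhysics.QuantumFieldTheory.LatticeForm (quo)
open Literature.MathematicalPhysics.QuantumFieldTheory.Balaban1983to89
open Literature.MathematicalPhysics.QuantumFieldTheory.Balaban1983to89.Beta
open AffineAveraging (Site Form1 unitVec curv curvAdj dz codiff₁)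
open B4ContourShift (supNorm supNorm_nonneg)
open KernelSpecInstance (wH)
open Summit.QuantumFields.BalabanUV.Beta.RemainderExplicitUnits (side side_pos hBal phiBal exists_uniform_bounds)
open Summit.QuantumFields.BalabanUV.Beta.RemainderExplicitLaplacian (exists_curvAdj_curv_wH_decay)
open Summit.QuantumFields.BalabanUV.Beta.RemainderExplicitDivGrad (exists_ddwH_decay)

namespace Summit.QuantumFields.BalabanUV.Beta.RemainderExplicitSecondOrder

/-! ## §1 The componentwise lattice Laplacian on 1-forms and the Hodge identity in the tree's conventions -/

section Hodge

variable {d : ℕ}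

/-- [folklore] THE COMPONENTWISE (positive) LATTICE LAPLACIAN on 1-forms: `(Δ_vec A)_ν(x) = Σ_μ (2A_ν(x) − A_ν(x+e_μ) − A_ν(x−e_μ))`
(symbol `Σ_μ (2 − 2cos k_μ) = Σ_μ ∂̂_μ∂̂♭_μ` on plane waves; at `U = 1` this is [Balaban1987RG1]'s `Δ^ξ_U` up to the factor `ξ⁻²` and the
sign convention). -/
def lapVec (A : Form1 d ℝ) : Form1 d ℝ := fun ν x => ∑ μ, (2 * A ν x - A ν (x + unitVec μ) - A ν (x - unitVec μ))

/-- [folklore] **THE HODGE IDENTITY IN THE TREE'S CONVENTIONS**: `curvAdj (curv A) = 2·Δ_vec A − 2·dz (codiff₁ A)` pointwise — `curv` lives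
on all ordered pairs of directions (`curv A l κ = −curv A κ l`), so the formal adjoint pairing double-counts and `curvAdj ∘ curv = 2·(d*d)`,
while `dz ∘ codiff₁ = d d*` and `d*d + d d* = Δ_vec` (flat lattice). -/
theorem curvAdj_curv_eq (A : Form1 d ℝ) (μ : Fin d) (y : Site d) :
    curvAdj (curv A) μ y = 2 * lapVec A μ y - 2 * dz (codiff₁ A) μ y := by
  have h : ∀ κ : Fin d, y - unitVec κ + unitVec μ = y + unitVec μ - unitVec κ := fun κ => by abel
  -- both sides as ONE sum over the direction index
  have lhs : curvAdj (curv A) μ y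
      = ∑ l, ((curv A μ l y - curv A μ l (y - unitVec l)) + (curv A l μ (y - unitVec l) - curv A l μ y)) := by
    simp only [curvAdj, ← Finset.sum_add_distrib]
  have rhs : 2 * lapVec A μ y - 2 * dz (codiff₁ A) μ y
      = ∑ l, (2 * (2 * A μ y - A μ (y + unitVec l) - A μ (y - unitVec l))
          - 2 * ((A l (y + unitVec μ - unitVec l) - A l (y + unitVec μ)) - (A l (y - unitVec l) - A l y))) := by
    simp only [lapVec, dz, codiff₁]
    rw [← Finset.sum_sub_distrib, Finset.mul_sum, Finset.mul_sum, ← Finset.sum_sub_distrib]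
  rw [lhs, rhs]
  refine Finset.sum_congr rfl fun l _ => ?_
  simp only [curv, sub_add_cancel, h]
  ring

/-- [folklore] Consequently `|Δ_vec A| ≤ ½|curvAdj (curv A)| + |dz (codiff₁ A)|` pointwise. -/
theorem abs_lapVec_le (A : Form1 d ℝ) (μ : Fin d) (y : Site d) :
    |lapVec A μ y| ≤ 1 / 2 * |curvAdj (curv A) μ y| + |dz (codiff₁ A) μ y| := by
  have h := curvAdj_curv_eq A μ y
  have e : lapVec A μ y = 1 / 2 * curvAdj (curv A) μ y + dz (codiff₁ A) μ y := by linarith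
  rw [e]
  refine (abs_add_le _ _).trans (le_of_eq ?_)
  rw [abs_mul, abs_of_pos (by norm_num : (0 : ℝ) < 1 / 2)]

/-- [folklore] `Δ_vec` commutes with scalars. -/
theorem lapVec_smul (c : ℝ) (A : Form1 d ℝ) (ν : Fin d) (x : Site d) :
    lapVec (fun κ z => c * A κ z) ν x = c * lapVec A ν x := by
  simp only [lapVec, Finset.mul_sum]
  exact Finset.sum_congr rfl fun _ _ => by ring

/-- [folklore] `dz ∘ codiff₁` commutes with scalars. -/
theorem dz_codiff₁_smul (c : ℝ) (A : Form1 d ℝ) (ν : Fin d) (x : Site d) :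
    dz (codiff₁ (fun κ z => c * A κ z)) ν x = c * dz (codiff₁ A) ν x := by
  simp only [dz, codiff₁, Finset.mul_sum, mul_sub, Finset.sum_sub_distrib]

end Hodge

/-! ## §2 The componentwise Laplacian of the minimiser column is `O(N^{−(d+2)}·N^{−2})`, level-uniformly (`d + 1 = 4`) -/

section Four

variable {Lc : ℕ} [NeZero Lc]

/-- [folklore] Weakening `C′e^{−κ′t} ≤ Ce^{−κ₀t}` for `C′ ≤ C`, `κ₀ ≤ κ′`, `t ≥ 0`, `C ≥ 0`. -/
theorem weaken {C C' κ₀ κ' t : ℝ} (hC : C' ≤ C) (hC0 : 0 ≤ C) (hκ : κ₀ ≤ κ') (ht : 0 ≤ t) :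
    C' * Real.exp (-(κ' * t)) ≤ C * Real.exp (-(κ₀ * t)) := by
  have he : Real.exp (-(κ' * t)) ≤ Real.exp (-(κ₀ * t)) := Real.exp_le_exp.mpr (by nlinarith)
  calc C' * Real.exp (-(κ' * t)) ≤ C * Real.exp (-(κ' * t)) := mul_le_mul_of_nonneg_right hC (Real.exp_nonneg _)
    _ ≤ C * Real.exp (-(κ₀ * t)) := mul_le_mul_of_nonneg_left he hC0

/-- [folklore] **`|Δ_vec wH| ≲ N^{−5}·N^{−2}` LEVEL-UNIFORMLY** (d + 1 = 4): ONE `(κ₀, C)` such that for every level `N = Lc^(j+1)`, every fine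
point, source direction and component, `|Δ_vec (wH-column l) ν x| ≤ C·(N^5)⁻¹·(N^2)⁻¹·e^{−κ₀‖quo_N x‖∞}` — by the Hodge identity from
`exists_curvAdj_curv_wH_decay` (`d*d`) and `exists_ddwH_decay` (`d d*`) BY NAME. -/
theorem exists_lapVec_wH_decay :
    ∃ κ₀ C : ℝ, 0 < κ₀ ∧ 0 ≤ C ∧ ∀ (j : ℕ) (l ν : Fin 4) (x : Fin 4 → ℤ),
      |lapVec (fun κ z => wH (N := Lc ^ (j + 1)) κ l z) ν x|
        ≤ C * (((Lc ^ (j + 1) : ℕ) : ℝ) ^ 5)⁻¹ * ((((Lc ^ (j + 1) : ℕ) : ℝ)) ^ 2)⁻¹ *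
          Real.exp (-(κ₀ * supNorm (quo (Lc ^ (j + 1)) x))) := by
  obtain ⟨κ₁, C₁, hκ₁, hC₁, h₁⟩ := exists_curvAdj_curv_wH_decay (Lc := Lc)
  obtain ⟨κ₂, C₂, hκ₂, hC₂, h₂⟩ := exists_ddwH_decay (Lc := Lc)
  refine ⟨min κ₁ κ₂, 1 / 2 * C₁ + C₂, lt_min hκ₁ hκ₂, by positivity, fun j l ν x => ?_⟩
  set Nr : ℝ := ((Lc ^ (j + 1) : ℕ) : ℝ) with hNr
  have hN : 0 < Nr := by rw [hNr]; exact_mod_cast pow_pos (Nat.pos_of_ne_zero (NeZero.ne Lc)) _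
  set t : ℝ := supNorm (quo (Lc ^ (j + 1)) x) with ht
  have ht0 : 0 ≤ t := supNorm_nonneg _
  have hP : 0 ≤ (Nr ^ 5)⁻¹ * (Nr ^ 2)⁻¹ := by positivity
  have b1 := h₁ j l ν x
  have b2 := h₂ j l ν x
  have w1 : C₁ * (Nr ^ 5)⁻¹ * (Nr ^ 2)⁻¹ * Real.exp (-(κ₁ * t)) ≤ C₁ * (Nr ^ 5)⁻¹ * (Nr ^ 2)⁻¹ * Real.exp (-(min κ₁ κ₂ * t)) := by
    have := weaken (le_refl (C₁ * (Nr ^ 5)⁻¹ * (Nr ^ 2)⁻¹)) (by positivity) (min_le_left κ₁ κ₂) ht0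
    simpa [mul_assoc] using this
  have w2 : C₂ * (Nr ^ 5)⁻¹ * (Nr ^ 2)⁻¹ * Real.exp (-(κ₂ * t)) ≤ C₂ * (Nr ^ 5)⁻¹ * (Nr ^ 2)⁻¹ * Real.exp (-(min κ₁ κ₂ * t)) := by
    have := weaken (le_refl (C₂ * (Nr ^ 5)⁻¹ * (Nr ^ 2)⁻¹)) (by positivity) (min_le_right κ₁ κ₂) ht0
    simpa [mul_assoc] using this
  calc |lapVec (fun κ z => wH (N := Lc ^ (j + 1)) κ l z) ν x|
      ≤ 1 / 2 * |curvAdj (curv (fun κ z => wH (N := Lc ^ (j + 1)) κ l z)) ν x|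
          + |dz (codiff₁ (fun κ z => wH (N := Lc ^ (j + 1)) κ l z)) ν x| := abs_lapVec_le _ ν x
    _ ≤ 1 / 2 * (C₁ * (Nr ^ 5)⁻¹ * (Nr ^ 2)⁻¹ * Real.exp (-(min κ₁ κ₂ * t)))
          + C₂ * (Nr ^ 5)⁻¹ * (Nr ^ 2)⁻¹ * Real.exp (-(min κ₁ κ₂ * t)) :=
        add_le_add (mul_le_mul_of_nonneg_left (b1.trans w1) (by norm_num)) (b2.trans w2)
    _ = (1 / 2 * C₁ + C₂) * (Nr ^ 5)⁻¹ * (Nr ^ 2)⁻¹ * Real.exp (-(min κ₁ κ₂ * t)) := by ring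

/-! ## §3 In Bałaban's units: `N²·|Δ_vec h|` and `N²·|d d* h|` are level-free; all four components with one pair of constants -/

/-- [folklore] **COMPONENT `|Δ^ξ𝐀|_X`: `N²·|Δ_vec h|` IS LEVEL-FREE** — `N_j²·|Δ_vec (hBal-column l) ν x| ≤ C·e^{−κ₀‖quo_{N_j} x‖∞}` with ONE
`(κ₀, C)` for every level (`exists_lapVec_wH_decay` × `N^5·N²`: `Δ^ξ = ξ⁻²Δ = N²Δ`). -/
theorem exists_lap_hBal_bound :
    ∃ κ₀ C : ℝ, 0 < κ₀ ∧ 0 ≤ C ∧ ∀ (j : ℕ) (l ν : Fin 4) (x : Fin 4 → ℤ),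
      side Lc j ^ 2 * |lapVec (fun κ z => hBal Lc j κ l z) ν x| ≤ C * Real.exp (-(κ₀ * supNorm (quo (Lc ^ (j + 1)) x))) := by
  obtain ⟨κ₀, C, hκ₀, hC, h⟩ := exists_lapVec_wH_decay (Lc := Lc)
  refine ⟨κ₀, C, hκ₀, hC, fun j l ν x => ?_⟩
  have hN : 0 < side Lc j := side_pos j
  have hb := h j l ν x
  have e : (fun κ z => hBal Lc j κ l z) = fun κ z => side Lc j ^ 5 * wH (N := Lc ^ (j + 1)) κ l z := by
    funext κ z; rfl
  rw [e, lapVec_smul, abs_mul, abs_of_pos (pow_pos hN 5), ← mul_assoc]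
  calc side Lc j ^ 2 * side Lc j ^ 5 * |lapVec (fun κ z => wH (N := Lc ^ (j + 1)) κ l z) ν x|
      ≤ side Lc j ^ 2 * side Lc j ^ 5 *
          (C * ((side Lc j) ^ 5)⁻¹ * ((side Lc j) ^ 2)⁻¹ * Real.exp (-(κ₀ * supNorm (quo (Lc ^ (j + 1)) x)))) :=
        mul_le_mul_of_nonneg_left hb (by positivity)
    _ = C * Real.exp (-(κ₀ * supNorm (quo (Lc ^ (j + 1)) x))) := by
        field_simp

/-- [folklore] **COMPONENT `|P₁𝐀|_X` AS READ ON ROAD P3 (`P₁h = d d* h`): `N²·|d d* h|` IS LEVEL-FREE** — `N_j²·|dz (codiff₁ (hBal-column l)) ν x|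
≤ C·e^{−κ₀‖quo_{N_j} x‖∞}` with ONE `(κ₀, C)` for every level (`exists_ddwH_decay` × `N^5·N²`). -/
theorem exists_divgrad_hBal_bound :
    ∃ κ₀ C : ℝ, 0 < κ₀ ∧ 0 ≤ C ∧ ∀ (j : ℕ) (l ν : Fin 4) (x : Fin 4 → ℤ),
      side Lc j ^ 2 * |dz (codiff₁ (fun κ z => hBal Lc j κ l z)) ν x| ≤ C * Real.exp (-(κ₀ * supNorm (quo (Lc ^ (j + 1)) x))) := by
  obtain ⟨κ₀, C, hκ₀, hC, h⟩ := exists_ddwH_decay (Lc := Lc)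
  refine ⟨κ₀, C, hκ₀, hC, fun j l ν x => ?_⟩
  have hN : 0 < side Lc j := side_pos j
  have hb := h j l ν x
  have e : (fun κ z => hBal Lc j κ l z) = fun κ z => side Lc j ^ 5 * wH (N := Lc ^ (j + 1)) κ l z := by
    funext κ z; rfl
  rw [e, dz_codiff₁_smul, abs_mul, abs_of_pos (pow_pos hN 5), ← mul_assoc]
  calc side Lc j ^ 2 * side Lc j ^ 5 * |dz (codiff₁ (fun κ z => wH (N := Lc ^ (j + 1)) κ l z)) ν x|
      ≤ side Lc j ^ 2 * side Lc j ^ 5 *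
          (C * ((side Lc j) ^ 5)⁻¹ * ((side Lc j) ^ 2)⁻¹ * Real.exp (-(κ₀ * supNorm (quo (Lc ^ (j + 1)) x)))) :=
        mul_le_mul_of_nonneg_left hb (by positivity)
    _ = C * Real.exp (-(κ₀ * supNorm (quo (Lc ^ (j + 1)) x))) := by
        field_simp

/-- [folklore] **ALL FOUR (3.14)/(4.4)-TYPE COMPONENTS OF THE TYPED TEST CONFIGURATION ARE LEVEL-FREE, WITH ONE PAIR OF CONSTANTS**
(d + 1 = 4; `h = hBal` the Bałaban-normalised column of the typed `U = 1` minimiser, `N_j = Lc^{j+1} = ξ⁻¹`): ONE `(κ₀, C)`, `κ₀ > 0`,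
such that for every level `j`, every source direction `l`, every component and every fine point,
`|h| ≤ C·e^{−κ₀‖quo z‖∞}`, `N_j·|∇h| ≤ C·e^{…}`, `N_j²·|Δ_vec h| ≤ C·e^{…}`, `N_j²·|d d* h| ≤ C·e^{…}` — i.e. `max{|h|, N|∇h|,
N²|Δ_vec h|, N²|dd*h|}` at a fine point is bounded by `C` times the exponential of minus `κ₀` times the sup-distance OF ITS BLOCK from
the source block, uniformly in the level: the shape of [Balaban1987RG1] p. 282's `j`-uniform `B₃` with the decay factor, for the
explicit operator (the identification with print's object being the READING (R13-2)/(R14-1), not asserted). -/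
theorem exists_norm314_bounds :
    ∃ κ₀ C : ℝ, 0 < κ₀ ∧ 0 ≤ C ∧
      (∀ (j : ℕ) (κ l : Fin 4) (z : Fin 4 → ℤ), |hBal Lc j κ l z| ≤ C * Real.exp (-(κ₀ * supNorm (quo (Lc ^ (j + 1)) z)))) ∧
      (∀ (j : ℕ) (κ l ν : Fin 4) (z : Fin 4 → ℤ),
        side Lc j * |hBal Lc j κ l (z + unitVec ν) - hBal Lc j κ l z| ≤ C * Real.exp (-(κ₀ * supNorm (quo (Lc ^ (j + 1)) z)))) ∧
      (∀ (j : ℕ) (l ν : Fin 4) (x : Fin 4 → ℤ),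
        side Lc j ^ 2 * |lapVec (fun κ z => hBal Lc j κ l z) ν x| ≤ C * Real.exp (-(κ₀ * supNorm (quo (Lc ^ (j + 1)) x)))) ∧
      (∀ (j : ℕ) (l ν : Fin 4) (x : Fin 4 → ℤ),
        side Lc j ^ 2 * |dz (codiff₁ (fun κ z => hBal Lc j κ l z)) ν x| ≤ C * Real.exp (-(κ₀ * supNorm (quo (Lc ^ (j + 1)) x)))) := by
  obtain ⟨κ₁, C₁, hκ₁, hC₁, h₁, h₂, _h₃⟩ := exists_uniform_bounds (Lc := Lc)
  obtain ⟨κ₃, C₃, hκ₃, hC₃, h₃⟩ := exists_lap_hBal_bound (Lc := Lc)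
  obtain ⟨κ₄, C₄, hκ₄, hC₄, h₄⟩ := exists_divgrad_hBal_bound (Lc := Lc)
  set κ₀ : ℝ := min κ₁ (min κ₃ κ₄) with hκ₀
  set C : ℝ := max C₁ (max C₃ C₄) with hC
  have hk1 : κ₀ ≤ κ₁ := min_le_left _ _
  have hk3 : κ₀ ≤ κ₃ := (min_le_right _ _).trans (min_le_left _ _)
  have hk4 : κ₀ ≤ κ₄ := (min_le_right _ _).trans (min_le_right _ _)
  have hc1 : C₁ ≤ C := le_max_left _ _
  have hc3 : C₃ ≤ C := (le_max_left _ _).trans (le_max_right _ _)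
  have hc4 : C₄ ≤ C := (le_max_right _ _).trans (le_max_right _ _)
  have hC0 : 0 ≤ C := hC₁.trans hc1
  refine ⟨κ₀, C, lt_min hκ₁ (lt_min hκ₃ hκ₄), hC0, fun j κ l z => ?_, fun j κ l ν z => ?_, fun j l ν x => ?_,
    fun j l ν x => ?_⟩
  · exact (h₁ j κ l z).trans (weaken hc1 hC0 hk1 (supNorm_nonneg _))
  · exact (h₂ j κ l ν z).trans (weaken hc1 hC0 hk1 (supNorm_nonneg _))
  · exact (h₃ j l ν x).trans (weaken hc3 hC0 hk3 (supNorm_nonneg _))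
  · exact (h₄ j l ν x).trans (weaken hc4 hC0 hk4 (supNorm_nonneg _))

end Four

end Summit.QuantumFields.BalabanUV.Beta.RemainderExplicitSecondOrder

end
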